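import Summits.NavierStokesRegularity.NavierStokesRegularity.Theorems.EulerZoomLiouvillePowerGaugeEulerLiouvilleEnergySaturationPressureLoc
import Summits.NavierStokesRegularity.NavierStokesRegularity.Theorems.EulerZoomLiouvillePowerGaugeEulerLiouvilleEnergySaturationFlux

/-!
# Energy saturation on rung C1 of the crux `EulerZoomLiouville.PowerGaugeEulerLiouville` — LARGE-SCALE re-plumb, IV:
# the flux weight through the tail supremum under THRESHOLDED ball growth
# (crux = stmt-NavierStokesRegularity-19832, route №10 `EulerZoomLiouville`, line `birth`)

Width seat `ns-ezl-w1` (RESIDUE-MEMO-19832-g9 §2).  Sequel of `…EnergySaturationPressureLoc`: the tree's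
`exists_fluxWeight_le_of_sup` (`…EnergySaturationFlux`) re-proved VERBATIM with the all-scale `A`-growth and the global
`E`/`D`-weights replaced by the thresholded ball forms (A₁), (E₁), (D₁) for `L ≥ 1` (all radii used are `R = 8r ≥ 8`):

* `exists_fluxWeight_le_of_sup_loc` — `|(2+ρ) r^{2ρ−2} F_σ(r)| ≤ A · S^{1/2} · r^{−1−(2+ρ)/4}` on `[L, ∞)` when `S` is an
  admissible tail supremum on `[L, ∞)`, `L ≥ 1`.

The tail estimate `abs_normEnergy_sub_le_of_fluxWeight_le` and the continuity `continuousAt_fluxWeight` of the tree take no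
gauge hypothesis and are used as they are.  WHAT THIS IS NOT: not NS regularity, not the crux, not rung C1 — plumbing for the
shifted / past-exact sub-extremal stratum; `--supports` stmt-19832. [folklore]
-/

noncomputable section

set_option linter.dupNamespace false

open MeasureTheory Set Filter Topology Metric Function TopologicalSpace
open scoped ENNReal NNReal RealInnerProductSpace ContDiff Laplacian

namespace Summit.NavierStokesRegularity.NavierStokesRegularity.Theorems.PowerGaugeEulerLiouville

open Literature.Analysis Literature.Analysis.FunctionSpaces Literature.Analysis.FluidPDE

namespace EnergySaturation

variable {ρ : ℝ} {σ : EuclideanSpace ℝ (Fin 3) → ℝ}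
  {V : EuclideanSpace ℝ (Fin 3) → EuclideanSpace ℝ (Fin 3)} {P : EuclideanSpace ℝ (Fin 3) → ℝ}
  {G : EuclideanSpace ℝ (Fin 3) → EuclideanSpace ℝ (Fin 3) →L[ℝ] EuclideanSpace ℝ (Fin 3)}

/-- **The flux weight through the tail supremum, LARGE-SCALE inputs** (A₁), (E₁), (D₁).  Under the class data (weak gradient, `A`-growth,
`E`- and `D`-weights, `0 < ρ < 1`), the weak Poisson equation and a cut-off `σ` as in
`exists_radialCutoff`, there is `A ≥ 0` such that: if `0 ≤ S ≤ 3c`, `L ≥ 1` and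
`∫σ(R⁻¹y)|V|² ≤ R^{1−2ρ} S` for all `R ≥ L`, then for every `r ≥ L`
`|(2+ρ) r^{2ρ−2} F_σ(r)| ≤ A · S^{1/2} · r^{−1−(2+ρ)/4}`, `F_σ(r) = ∫(|V|²+2P)⟪V,∇σ_r⟫`. [folklore] -/
theorem exists_fluxWeight_le_of_sup_loc (hρ : 0 < ρ) (hρ1 : ρ < 1)
    (hσ : IsTestFunctionOn (⊤ : Opens (EuclideanSpace ℝ (Fin 3))) σ) (h0 : ∀ z, 0 ≤ σ z)
    (h1 : ∀ z, σ z ≤ 1) (hone : ∀ z, ‖z‖ ≤ 1 → σ z = 1) (hzero : ∀ z, 2 ≤ ‖z‖ → σ z = 0)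
    (hVm : AEStronglyMeasurable V volume) (hPm : AEStronglyMeasurable P volume)
    (hGm : AEStronglyMeasurable G volume)
    (hVG : HasWeakFDerivOn (⊤ : Opens (EuclideanSpace ℝ (Fin 3))) volume V G) {c : ℝ≥0}
    (hA : ∀ L : ℝ, 1 ≤ L → ∫⁻ y in ball (0 : EuclideanSpace ℝ (Fin 3)) L, ‖V y‖ₑ ^ 2 ≤
      (c : ℝ≥0∞) * ENNReal.ofReal (L ^ (1 - 2 * ρ)))
    (hE : ∀ L : ℝ, 1 ≤ L →
      ∫⁻ y in ball (0 : EuclideanSpace ℝ (Fin 3)) L, ENNReal.ofReal (frobeniusNormSq (G y)) ≤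
        ENNReal.ofReal (L ^ (1 - ρ)) * (ENNReal.ofReal ((1 - ρ) / (2 + ρ)) * (c : ℝ≥0∞)))
    (hD : ∀ L : ℝ, 1 ≤ L →
      ∫⁻ y in ball (0 : EuclideanSpace ℝ (Fin 3)) L, ‖P y‖ₑ ^ (3 / 2 : ℝ) ≤
        ENNReal.ofReal (L ^ (2 - 2 * ρ)) * (ENNReal.ofReal ((2 - 2 * ρ) / (2 + ρ)) * (c : ℝ≥0∞)))
    (hPoisson : ∀ θ : EuclideanSpace ℝ (Fin 3) → ℝ, ContDiff ℝ (⊤ : ℕ∞) θ → HasCompactSupport θ →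
      ∫ y, P y * (Δ θ) y = -∫ y, fderiv ℝ (fderiv ℝ θ) y (V y) (V y)) :
    ∃ A : ℝ, 0 ≤ A ∧ ∀ S : ℝ, 0 ≤ S → S ≤ 3 * c → ∀ L : ℝ, 1 ≤ L →
      (∀ R : ℝ, L ≤ R → ∫ y, σ (R⁻¹ • y) * ‖V y‖ ^ 2 ≤ R ^ (1 - 2 * ρ) * S) →
      ∀ r : ℝ, L ≤ r →
        |(2 + ρ) * r ^ (2 * ρ - 2) *
            ∫ x, (‖V x‖ ^ 2 + 2 * P x) * ⟪V x, gradient (fun z => σ (r⁻¹ • z)) x⟫| ≤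
          A * S ^ (1 / 2 : ℝ) * r ^ (-1 - (2 + ρ) / 4) := by
  have hc0 : (0 : ℝ) ≤ c := c.2
  have hσd : Differentiable ℝ σ := hσ.contDiff.differentiable (by simp)
  obtain ⟨M, hM⟩ := (hσ.contDiff.continuous_fderiv (by simp)).bounded_above_of_compact_support
    (hσ.hasCompactSupport.fderiv (𝕜 := ℝ))
  have hM0 : 0 ≤ M := (norm_nonneg _).trans (hM 0)
  -- the constants of files IV–V
  set K₂ : ℝ := ((SNormLESNormFDerivOfEqConst (EuclideanSpace ℝ (Fin 3))
      (volume : Measure (EuclideanSpace ℝ (Fin 3))) 2 : ℝ) ^ (3 / 2 : ℝ) *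
    (2 * (3 : ℝ) ^ (1 - ρ) * ((1 - ρ) / (2 + ρ) * c) + 6 * M ^ 2 * (3 : ℝ) ^ (1 - 2 * ρ) * c) ^ (3 / 4 : ℝ) *
    (3 * c) ^ (1 / 4 : ℝ)) with hK₂
  have h1ρ : 0 ≤ (1 - ρ) / (2 + ρ) := by apply div_nonneg <;> linarith
  have hK₂0 : 0 ≤ K₂ := by positivity
  obtain ⟨K₇, hK₇0, hK₇⟩ := exists_lintegral_halfBall_pressure_velocity_le_of_sup_loc hρ hρ1 hσ h0 h1 hone hzero
    hM hVm hPm hGm hVG hA hE hD hPoisson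
  have hloc3 := (locallyIntegrable_norm_cube_loc hρ hρ1 hσ h0 h1 hone hzero hM hVm hGm hVG hA hE).2
  have hlocPV := (locallyIntegrable_pressure_velocity_loc hρ hρ1 hσ h0 h1 hone hzero hM hVm hPm hGm hVG hA hE
    hD hPoisson).2
  set E : ℝ := (6 - 9 * ρ) / 4 with hEdef
  refine ⟨(2 + ρ) * M * (K₂ + 2 * K₇) * (8 : ℝ) ^ E, by positivity, ?_⟩
  intro S hS hS3 L hL hsup r hr
  have hr1 : 1 ≤ r := hL.trans hr
  have hr0 : 0 < r := lt_of_lt_of_le one_pos hr1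
  set R : ℝ := 8 * r with hRdef
  have hR1 : 1 ≤ R := by rw [hRdef]; linarith
  have hR0 : 0 < R := by positivity
  have hRL : L ≤ R := by rw [hRdef]; linarith
  have hsupR := hsup R hRL
  have hS12 : 0 ≤ S ^ (1 / 2 : ℝ) := Real.rpow_nonneg hS _
  have hRE : 0 ≤ R ^ E := Real.rpow_nonneg hR0.le _
  -- the two ball bounds at scale `R = 8r`
  have hC3 := lintegral_ball_cube_le_of_sup_loc hρ hρ1 hσ h0 h1 hone hzero hM hVm hGm hVG hA hE hS hS3 hR1 hsupR
  rw [← hK₂] at hC3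
  have hPV := hK₇ S hS hS3 R hR1 hsupR
  -- real forms on the shell `r ≤ |y| ≤ 2r ⊆ B_{R/2} ⊆ B_R`
  set Sh : Set (EuclideanSpace ℝ (Fin 3)) := {y | r ≤ ‖y‖ ∧ ‖y‖ ≤ 2 * r} with hSh
  have hShm : MeasurableSet Sh :=
    ((isClosed_le continuous_const continuous_norm).inter (isClosed_le continuous_norm continuous_const)).measurableSet
  have hShR2 : Sh ⊆ ball (0 : EuclideanSpace ℝ (Fin 3)) (R / 2) := fun y hy => by
    rw [mem_ball, dist_zero_right, hRdef]; linarith [hy.2]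
  have hShR : Sh ⊆ ball (0 : EuclideanSpace ℝ (Fin 3)) R :=
    hShR2.trans (ball_subset_ball (by linarith))
  have hcube_real : ∫ y in Sh, ‖V y‖ ^ 3 ≤ K₂ * S ^ (1 / 2 : ℝ) * R ^ E := by
    refine setIntegral_le_of_lintegral_le (fun y => by positivity) (by positivity) ?_
    refine (lintegral_mono_set hShR).trans (le_trans (le_of_eq (lintegral_congr fun y => ?_)) hC3)
    rw [ENNReal.ofReal_pow (norm_nonneg _), ofReal_norm]
  have hPV_real : ∫ y in Sh, |P y| * ‖V y‖ ≤ K₇ * S ^ (1 / 2 : ℝ) * R ^ E := by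
    refine setIntegral_le_of_lintegral_le (fun y => by positivity) (by positivity) ?_
    refine (lintegral_mono_set hShR2).trans (le_trans (le_of_eq (lintegral_congr fun y => ?_)) hPV)
    rw [ENNReal.ofReal_mul (abs_nonneg _), ← Real.norm_eq_abs, ofReal_norm, ofReal_norm]
  -- the shell density integral
  have hX : ∫ y in Sh, (‖V y‖ ^ 3 + 2 * |P y| * ‖V y‖) ≤ (K₂ + 2 * K₇) * S ^ (1 / 2 : ℝ) * R ^ E := by
    have hi1 : IntegrableOn (fun y => ‖V y‖ ^ 3) Sh volume :=
      (hloc3.integrableOn_isCompact (isCompact_closedBall (0 : EuclideanSpace ℝ (Fin 3)) (2 * r))).mono_set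
        (fun y hy => by rw [mem_closedBall, dist_zero_right]; exact hy.2)
    have hi2 : IntegrableOn (fun y => |P y| * ‖V y‖) Sh volume :=
      (hlocPV.integrableOn_isCompact (isCompact_closedBall (0 : EuclideanSpace ℝ (Fin 3)) (2 * r))).mono_set
        (fun y hy => by rw [mem_closedBall, dist_zero_right]; exact hy.2)
    have e : ∫ y in Sh, (‖V y‖ ^ 3 + 2 * |P y| * ‖V y‖) =
        (∫ y in Sh, ‖V y‖ ^ 3) + 2 * ∫ y in Sh, |P y| * ‖V y‖ := by
      rw [← integral_const_mul, ← integral_add hi1 (hi2.const_mul 2)]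
      refine integral_congr_ae (Eventually.of_forall fun y => ?_)
      simp only; ring
    rw [e]
    nlinarith [hcube_real, hPV_real]
  -- the flux bound of file I
  have hF := abs_flux_le hσd h0 h1 hone hzero hM hloc3 hlocPV hr0
  -- assemble
  have hX0 : 0 ≤ ∫ y in Sh, (‖V y‖ ^ 3 + 2 * |P y| * ‖V y‖) :=
    setIntegral_nonneg hShm fun y _ => by positivity
  have hpow : r ^ (2 * ρ - 2) * r⁻¹ * R ^ E = (8 : ℝ) ^ E * r ^ (-1 - (2 + ρ) / 4) := by
    rw [hRdef, Real.mul_rpow (by norm_num) hr0.le, ← Real.rpow_neg_one r]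
    have : r ^ (2 * ρ - 2) * r ^ (-1 : ℝ) * r ^ E = r ^ (-1 - (2 + ρ) / 4) := by
      rw [← Real.rpow_add hr0, ← Real.rpow_add hr0, hEdef]; ring_nf
    calc r ^ (2 * ρ - 2) * r ^ (-1 : ℝ) * ((8 : ℝ) ^ E * r ^ E)
        = (8 : ℝ) ^ E * (r ^ (2 * ρ - 2) * r ^ (-1 : ℝ) * r ^ E) := by ring
      _ = _ := by rw [this]
  rw [abs_mul, abs_mul, abs_of_pos (by linarith : (0 : ℝ) < 2 + ρ),
    abs_of_nonneg (Real.rpow_nonneg hr0.le _)]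
  calc (2 + ρ) * r ^ (2 * ρ - 2) *
        |∫ x, (‖V x‖ ^ 2 + 2 * P x) * ⟪V x, gradient (fun z => σ (r⁻¹ • z)) x⟫|
      ≤ (2 + ρ) * r ^ (2 * ρ - 2) * (M / r * ∫ y in Sh, (‖V y‖ ^ 3 + 2 * |P y| * ‖V y‖)) := by
        gcongr
    _ ≤ (2 + ρ) * r ^ (2 * ρ - 2) * (M / r * ((K₂ + 2 * K₇) * S ^ (1 / 2 : ℝ) * R ^ E)) := by
        gcongr
    _ = (2 + ρ) * M * (K₂ + 2 * K₇) * S ^ (1 / 2 : ℝ) * (r ^ (2 * ρ - 2) * r⁻¹ * R ^ E) := by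
        rw [div_eq_mul_inv]; ring
    _ = (2 + ρ) * M * (K₂ + 2 * K₇) * (8 : ℝ) ^ E * S ^ (1 / 2 : ℝ) * r ^ (-1 - (2 + ρ) / 4) := by
        rw [hpow]; ring

end EnergySaturation

end Summit.NavierStokesRegularity.NavierStokesRegularity.Theorems.PowerGaugeEulerLiouville

end
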